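import Literature.Computability.MetaComplexity.BoundedArithS2SuccIND
import HarnessLib

/-!
# `Σᵇᵢ-LIND` in models of `S₂ⁱ` (and `T₂ⁱ`); induction along an interval of lengths

Topic `Literature/Computability/MetaComplexity` (companion of `BoundedArithTheories.lean`,
`BoundedArithModels.lean`, `BoundedArithDefinability.lean`, `BoundedArithS2SuccIND.lean`).
The theories file defines the length-induction scheme `LINDScheme` (`LIND(φ)`:
`φ(0) ∧ ∀x (φ(x) → φ(x+1)) → ∀x φ(|x|)`, Buss 1986, §2.3; Krajíček 1995, Def. 5.2.4) but the tree
had no relation between it and `S₂ⁱ`, `T₂ⁱ`.  This file proves, semantically (provability is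
Mathlib's `⊨ᵇ`), the inclusions

* `Σᵇᵢ-LIND ⊆ S₂ⁱ` — **every `Σᵇᵢ-LIND` axiom is a consequence of `BASIC + Σᵇᵢ-PIND`**
  (Krajíček 1995, Lemma 5.2.5, p. 67: `S₂ⁱ = Σᵇᵢ-LIND`; we prove the inclusion `⊇` of theories,
  i.e. `S₂ⁱ ⊢ Σᵇᵢ-LIND`, which is the direction used in the bootstrapping of `S₂¹`, Buss 1986,
  Ch. 2): in a structure `M ⊨ BASIC + Σᵇᵢ-PIND`, for a predicate `A` that is `Σᵇᵢ`-definable with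
  parameters, `A(0) ∧ ∀k (A(k) → A(k+1))` gives `A(|a|)` for every `a` — by `Σᵇᵢ-PIND` on
  `x ↦ A(|x|)`, using only `|0| = 0` and `|x| = |⌊x/2⌋| + 1` (`x ≠ 0`) from `BASIC`
  (`BASICModel.lind_of_pind`, `lind_of_model_S2`, `model_LINDScheme_of_model_S2`,
  `LINDScheme_extends_S2`); the argument is uniform in `i ≥ 0`;
* `Σᵇᵢ-LIND ⊆ T₂ⁱ` (Krajíček 1995, proof of Lemma 5.2.8, p. 68: "`T₂ⁱ` implies the `Σᵇᵢ-LIND`",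
  trivially from `IND`) (`lind_of_model_T2`, `model_LINDScheme_of_model_T2`,
  `LINDScheme_extends_T2`);

and two standard consequences inside a model of `BASIC + Σᵇ₁-PIND` (first steps of the
bootstrapping of `S₂¹` inside an arbitrary model, Buss 1986, Ch. 2; as opposed to the layers
`BoundedArithAlgebra` … `BoundedArithQueries*`, which work in models of `T₂¹ = BASIC + Σᵇ₁-IND`):

* `BASICModel.exists_le_mLen_eq` — **every `k ≤ |a|` is a length**: `∃ y ≤ a, |y| = k`
  (`Σᵇ₁-PIND` on `a` for the `Σᵇ₁` formula `∀k ≤ |a| ∃y ≤ a (|y| = k)`);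
* `BASICModel.ind_le_mLen_of_pind` — **`Σᵇᵢ₊₁`-induction along the interval of lengths
  `[0, |a|]`**: `A(0) ∧ ∀k < |a| (A(k) → A(k+1)) → ∀k ≤ |a| A(k)` for `Σᵇᵢ₊₁`-definable `A`
  (from `LIND` for `k ≤ |a| → A(k)` and the previous item).

## References

* J. Krajíček, *Bounded Arithmetic, Propositional Logic and Complexity Theory*, CUP 1995,
  Def. 5.2.4 (`LIND`), Lemma 5.2.5 (p. 67: `S₂ⁱ = Σᵇᵢ-LIND = Πᵇᵢ-PIND = Πᵇᵢ-LIND`, `i ≥ 1`),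
  Lemma 5.2.8 (p. 68).
* S. R. Buss, *Bounded Arithmetic*, Bibliopolis 1986, Ch. 2 (§2.3: the schemes `IND`, `PIND`,
  `LIND`; the bootstrapping of `S₂¹`).

## Design choices

* As in `BoundedArithS2SuccIND.lean`, everything is first proved in an arbitrary structure
  `M ⊨ BASIC` (instance argument) carrying the scheme `Σᵇᵢ-PIND` as an explicit hypothesis
  `M ⊨ PINDScheme (sigmabFormulas i)`, in the algebraic notation of `BoundedArithAlgebra.lean`
  (namespace `BASICModel`), and then specialised to models of `S₂ⁱ = BASIC + Σᵇᵢ-PIND`.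
* Only the inclusion `Σᵇᵢ-LIND ⊆ S₂ⁱ` of Krajíček's Lemma 5.2.5 is formalised; the converse
  (`Σᵇᵢ-LIND ⊢ Σᵇᵢ-PIND`, which needs the `Σᵇ₁`-definition of "the first `x` bits of `a`") and
  the `Πᵇᵢ` variants are not claimed here.
-/

namespace Literature.Computability.MetaComplexity

open FirstOrder FirstOrder.Language

namespace BASICModel

variable {M : Type} [Language.boundedArith.Structure M] [hB : M ⊨ BASIC]

/-! ## `Σᵇᵢ-LIND` from `Σᵇᵢ-PIND` -/

section LIND

/-- **`Σᵇᵢ-LIND` in models of `BASIC + Σᵇᵢ-PIND`** (`S₂ⁱ ⊢ Σᵇᵢ-LIND`; Krajíček 1995,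
Lemma 5.2.5, p. 67; Buss 1986, Ch. 2): if `A ⊆ M` is `Σᵇᵢ`-definable with parameters, `A(0)`
and `∀k (A(k) → A(k+1))`, then `A(|a|)` for every `a`.  Proof: `Σᵇᵢ-PIND` on the
(`Σᵇᵢ`-definable) predicate `x ↦ A(|x|)`, since `|0| = 0` and `|x| = |⌊x/2⌋| + 1` for `x ≠ 0`.
[cite: Krajicek1995, Lemma 5.2.5 (p. 67)] -/
theorem lind_of_pind {i : ℕ} (hP : M ⊨ PINDScheme (sigmabFormulas i)) {A : M → Prop}
    (hA : IsSigmabDef i fun v : Fin 1 → M => A (v 0)) (h0 : A 0) (hs : ∀ k, A k → A (k + 1))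
    (a : M) : A (mLen a) := by
  refine IsSigmabDef.pinduction' hP (P := fun x => A (mLen x))
    (hA.comp₁ (IsTermFn.proj (m := 1) 0).len) ?_ ?_ a
  · rw [mZero_eq, mLen_zero]
    exact h0
  · intro x ih
    rcases eq_or_ne x 0 with rfl | hx
    · rw [mLen_zero]
      exact h0
    · rw [mLen_eq_mLen_mHalf_add_one hx]
      exact hs _ ih

/-- **Every `k ≤ |a|` is a length**: in a model of `BASIC + Σᵇ₁-PIND`, for every `a` and every
`k ≤ |a|` there is `y ≤ a` with `|y| = k`.  Proof: `Σᵇ₁-PIND` on `a` for the `Σᵇ₁` formula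
`∀k ≤ |a| ∃y ≤ a (|y| = k)`: for `a ≠ 0`, `|a| = |⌊a/2⌋| + 1`, so either `k ≤ |⌊a/2⌋|` (induction
hypothesis, `⌊a/2⌋ ≤ a`) or `k = |a|` (`y = a`) (bootstrapping of `S₂¹`, Buss 1986, Ch. 2).
[cite: Buss1986, Ch. 2] -/
theorem exists_le_mLen_eq (hP : M ⊨ PINDScheme (sigmabFormulas 1)) (a : M) {k : M}
    (hk : k ≤ mLen a) : ∃ y, y ≤ a ∧ mLen y = k := by
  revert hk
  refine IsSigmabDef.pinduction' hP
    (P := fun a => ∀ k, k ≤ mLen a → ∃ y, y ≤ a ∧ mLen y = k) ?_ ?_ ?_ a k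
  · have h2 : IsSigmabDef 1 fun w : Fin 2 → M => ∃ y, y ≤ w 0 ∧ mLen y = w 1 :=
      (IsSigmabDef.bexLE (i := 0)
        ((IsQFDef.eq (IsTermFn.proj (m := 3) 2).len (IsTermFn.proj 1)).isSigmabDef 1)
        (IsTermFn.proj 0)).of_iff fun w => by simp
    exact (IsSigmabDef.ballLELen (i := 0) h2 (IsTermFn.proj 0)).of_iff fun v => by simp
  · intro k hk
    rw [mZero_eq, mLen_zero] at hk
    refine ⟨0, ?_, ?_⟩
    · rw [mZero_eq]
    · rw [mLen_zero]
      exact (le_antisymm hk bot_le).symm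
  · intro a ih k hk
    rcases eq_or_ne a 0 with rfl | ha
    · rw [mLen_zero] at hk
      exact ⟨0, le_rfl, by rw [mLen_zero]; exact (le_antisymm hk bot_le).symm⟩
    · by_cases hk' : k ≤ mLen (mHalf a)
      · obtain ⟨y, hy, hyk⟩ := ih k hk'
        exact ⟨y, hy.trans (mHalf_le a), hyk⟩
      · refine ⟨a, le_rfl, le_antisymm ?_ hk⟩
        rw [mLen_eq_mLen_mHalf_add_one ha]
        exact (add_one_le_iff' _ _).2 (not_le.1 hk')

/-- **`Σᵇᵢ₊₁`-induction along the interval of lengths `[0, |a|]`** in a model of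
`BASIC + Σᵇᵢ₊₁-PIND`: if `A` is `Σᵇᵢ₊₁`-definable with parameters, `A(0)` and
`∀k < |a| (A(k) → A(k+1))`, then `A(k)` for all `k ≤ |a|`.  Proof: `Σᵇᵢ₊₁-LIND` (`lind_of_pind`)
for `k ≤ |a| → A(k)` gives `A(|y|)` for every `y` with `|y| ≤ |a|`, and every `k ≤ |a|` is such a
length (`exists_le_mLen_eq`) (bootstrapping of `S₂¹`, Buss 1986, Ch. 2; Krajíček 1995,
Lemma 5.2.5). [cite: Krajicek1995, Lemma 5.2.5 (p. 67)] -/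
theorem ind_le_mLen_of_pind {i : ℕ} (hP : M ⊨ PINDScheme (sigmabFormulas (i + 1)))
    {A : M → Prop} (hA : IsSigmabDef (i + 1) fun v : Fin 1 → M => A (v 0)) (a : M) (h0 : A 0)
    (hs : ∀ k, k < mLen a → A k → A (k + 1)) {k : M} (hk : k ≤ mLen a) : A k := by
  have hP1 : M ⊨ PINDScheme (sigmabFormulas 1) :=
    hP.mono (PINDScheme_mono (sigmabFormulas_mono_holds (Nat.succ_le_succ (Nat.zero_le i))))
  obtain ⟨y, -, rfl⟩ := exists_le_mLen_eq hP1 a hk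
  have hA' : IsSigmabDef (i + 1) fun v : Fin 1 → M => v 0 ≤ mLen a → A (v 0) :=
    IsSigmabDef.imp ((isQFDef_le (IsTermFn.proj 0) (IsTermFn.const (mLen a))).isPibDef _) hA
  have key := lind_of_pind hP (A := fun k => k ≤ mLen a → A k) hA' (fun _ => h0)
    (fun k ih hk1 => hs k ((add_one_le_iff' _ _).1 hk1) (ih (((add_one_le_iff' _ _).1 hk1).le)))
    y
  exact key hk

end LIND

end BASICModel

/-! ## Models of `S₂ⁱ` and of `T₂ⁱ` satisfy `Σᵇᵢ-LIND` -/

section Models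

open BASICModel

variable {M : Type} [Language.boundedArith.Structure M] {i : ℕ}

/-- **`Σᵇᵢ-LIND` in models of `S₂ⁱ`**: in a model of `S₂ⁱ`, length induction holds for every
predicate `Σᵇᵢ`-definable with parameters (Krajíček 1995, Lemma 5.2.5, p. 67: `S₂ⁱ ⊢ Σᵇᵢ-LIND`).
[cite: Krajicek1995, Lemma 5.2.5 (p. 67)] -/
theorem lind_of_model_S2 (hM : M ⊨ S2 i) {A : M → Prop}
    (hA : IsSigmabDef i fun v : Fin 1 → M => A (v 0)) (h0 : A (mZero M))
    (hs : ∀ a, A a → A (mSucc a)) (a : M) : A (mLen a) := by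
  haveI : M ⊨ BASIC := model_BASIC_of_model_S2 hM
  exact lind_of_pind (hM.mono Set.subset_union_right) hA h0
    (fun k hk => by rw [← mSucc_eq]; exact hs k hk) a

/-- Every `k ≤ |a|` is the length of some `y ≤ a`, in a model of `S₂ⁱ⁺¹` (bootstrapping of
`S₂¹`, Buss 1986, Ch. 2). [cite: Buss1986, Ch. 2] -/
theorem exists_mLen_eq_of_model_S2_succ (hM : M ⊨ S2 (i + 1)) (a k : M) (hk : MLe k (mLen a)) :
    ∃ y, MLe y a ∧ mLen y = k := by
  haveI : M ⊨ BASIC := model_BASIC_of_model_S2 hM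
  have hP1 : M ⊨ PINDScheme (sigmabFormulas 1) :=
    (model_PINDScheme_of_model_S2 (Nat.succ_le_succ (Nat.zero_le i)) hM)
  exact exists_le_mLen_eq hP1 a hk

/-- **A model of `S₂ⁱ` satisfies the scheme `Σᵇᵢ-LIND`** (`Σᵇᵢ-LIND ⊆ S₂ⁱ`; Krajíček 1995,
Lemma 5.2.5, p. 67): every `LIND` axiom of a `Σᵇᵢ` formula (with parameters) holds.
[cite: Krajicek1995, Lemma 5.2.5 (p. 67)] -/
theorem model_LINDScheme_of_model_S2 (hM : M ⊨ S2 i) : M ⊨ LINDScheme (sigmabFormulas i) := by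
  refine ⟨fun φ hφ => ?_⟩
  simp only [LINDScheme, Set.mem_iUnion, Set.mem_image] at hφ
  obtain ⟨k, ψ, hψ, rfl⟩ := hφ
  rw [realize_lindAxiom_iff]
  intro p h0 hs a
  exact lind_of_model_S2 hM (hψ.isSigmabDef_realize_snoc p) h0 hs a

/-- **`S₂ⁱ ⊢ Σᵇᵢ-LIND`**: every `Σᵇᵢ-LIND` axiom is a consequence (`⊨ᵇ`) of `S₂ⁱ`, i.e. `S₂ⁱ`
extends the theory `Σᵇᵢ-LIND` axiom-wise (Krajíček 1995, Lemma 5.2.5, p. 67, inclusion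
`Σᵇᵢ-LIND ⊆ S₂ⁱ`; uniform in `i ≥ 0`). [cite: Krajicek1995, Lemma 5.2.5 (p. 67)] -/
theorem LINDScheme_extends_S2 (i : ℕ) : (LINDScheme (sigmabFormulas i)).Extends (S2 i) := by
  intro φ hφ
  rw [Theory.models_sentence_iff]
  intro N
  haveI : (N : Type) ⊨ LINDScheme (sigmabFormulas i) := model_LINDScheme_of_model_S2 N.is_model
  exact Theory.realize_sentence_of_mem (LINDScheme (sigmabFormulas i)) hφ

/-- Every consequence of `BASIC + Σᵇᵢ-LIND` is a consequence of `S₂ⁱ` (Krajíček 1995,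
Lemma 5.2.5, p. 67). [cite: Krajicek1995, Lemma 5.2.5 (p. 67)] -/
theorem BASIC_union_LINDScheme_extends_S2 (i : ℕ) :
    (BASIC ∪ LINDScheme (sigmabFormulas i)).Extends (S2 i) := by
  intro φ hφ
  rcases hφ with hφ | hφ
  · exact Theory.models_sentence_of_mem (BASIC_subset_S2 i hφ)
  · exact LINDScheme_extends_S2 i φ hφ

/-- **`Σᵇᵢ-LIND` in models of `T₂ⁱ`**: in a model of `T₂ⁱ`, length induction holds for every
predicate `Σᵇᵢ`-definable with parameters (trivially from `Σᵇᵢ-IND`; Krajíček 1995, proof of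
Lemma 5.2.8, p. 68: "`T₂ⁱ` implies the `Σᵇᵢ-LIND`"). [cite: Krajicek1995, Lemma 5.2.8 (p. 68)] -/
theorem lind_of_model_T2 (hM : M ⊨ T2 i) {A : M → Prop}
    (hA : IsSigmabDef i fun v : Fin 1 → M => A (v 0)) (h0 : A (mZero M))
    (hs : ∀ a, A a → A (mSucc a)) (a : M) : A (mLen a) :=
  hA.induction hM h0 hs (mLen a)

/-- **A model of `T₂ⁱ` satisfies the scheme `Σᵇᵢ-LIND`** (Krajíček 1995, proof of Lemma 5.2.8,
p. 68). [cite: Krajicek1995, Lemma 5.2.8 (p. 68)] -/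
theorem model_LINDScheme_of_model_T2 (hM : M ⊨ T2 i) : M ⊨ LINDScheme (sigmabFormulas i) := by
  refine ⟨fun φ hφ => ?_⟩
  simp only [LINDScheme, Set.mem_iUnion, Set.mem_image] at hφ
  obtain ⟨k, ψ, hψ, rfl⟩ := hφ
  rw [realize_lindAxiom_iff]
  intro p h0 hs a
  exact lind_of_model_T2 hM (hψ.isSigmabDef_realize_snoc p) h0 hs a

/-- **`T₂ⁱ ⊢ Σᵇᵢ-LIND`**: every `Σᵇᵢ-LIND` axiom is a consequence (`⊨ᵇ`) of `T₂ⁱ` (Krajíček 1995,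
proof of Lemma 5.2.8, p. 68). [cite: Krajicek1995, Lemma 5.2.8 (p. 68)] -/
theorem LINDScheme_extends_T2 (i : ℕ) : (LINDScheme (sigmabFormulas i)).Extends (T2 i) := by
  intro φ hφ
  rw [Theory.models_sentence_iff]
  intro N
  haveI : (N : Type) ⊨ LINDScheme (sigmabFormulas i) := model_LINDScheme_of_model_T2 N.is_model
  exact Theory.realize_sentence_of_mem (LINDScheme (sigmabFormulas i)) hφ

/-- The standard model-theoretic reading: for every `Σᵇᵢ-LIND` axiom `φ`, `S₂ⁱ ⊨ᵇ φ` and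
`T₂ⁱ ⊨ᵇ φ` (Krajíček 1995, Lemma 5.2.5 and Lemma 5.2.8). [cite: Krajicek1995, Lemma 5.2.5 (p. 67)] -/
theorem models_S2_and_T2_of_mem_LINDScheme {φ : Language.boundedArith.Sentence}
    (hφ : φ ∈ LINDScheme (sigmabFormulas i)) : S2 i ⊨ᵇ φ ∧ T2 i ⊨ᵇ φ :=
  ⟨LINDScheme_extends_S2 i φ hφ, LINDScheme_extends_T2 i φ hφ⟩

end Models

end Literature.Computability.MetaComplexity
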